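import Mathlib
import HarnessLib
import HarnessLib.Audit
import Summits.CriticalPhenomena.Statement
import Literature.Probability.Percolation.TwoPointFunction

/-!
Route: PercAxialLogConvexity

DORMANT since 2026-08-26T07:51:00Z (reconciler: no traction for 8.4 d (last activity item-evidence-added at 2026-08-17T21:52:39Z); parked, not closed — `ledger route dormant route-CriticalPhenomena-PercAxialLogConvexity --off` to reacti) — unstaffed, not closed; items shared with open routes are served there. `ledger route dormant <id> --off` reactivates.

# Route PercAxialLogConvexity — the axial effective mass never bends back — log-convexity of
τ_p(0,ne₁) in n plus block crossover at scale ξ forces θ(p_c)=0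

It suffices to show X = AxialLogConvex ∧ BlockCrossover (card axial-effective-mass-log-convexity,
its K1 ∧ K2). Write
a_p(n) := τ_p(0, n e₁) = P_p(0 ↔ (n,0,0)) for bond percolation on ℤ³
(`Literature.Probability.Percolation.tau 3 p 0 (Pi.single 0 n)`).
AxialLogConvex (LCX): for every p ≤ p_c(ℤ³) and every n, a_p(n+1)² ≤ a_p(n)·a_p(n+2) — the axial
effective mass
m_eff(n;p) = log a_p(n) − log a_p(n+1) is non-increasing in n ("never bends back"); it is the
order-2, collinear shadow of
Källén–Lehmann / OS positivity, which themselves FAIL for percolation. BlockCrossover: there are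
constants c' < c, parameters
0 < p_k ≤ p_c, scales N_k → ∞ (unbounded) and C_k with a_{p_k}(n) ≤ C_k e^{−(c/N_k) n} for all n (so
N_k ≳ c·ξ(p_k)) and, on the
dyadic block N_k/2 ≤ n ≤ N_k, e^{−c'/N_k} a_{p_k}(n) a_{p_c}(n+1) ≤ a_{p_k}(n+1) a_{p_c}(n)
(critical axial ratios exceed the
subcritical ones by at most a factor e^{c'/N_k} on the top block below scale N_k). A pure
real-analysis support item KinkCriterion
(slopes of a bounded-below log-convex sequence cannot be pushed below −(c−c')/N on infinitely many
disjoint dyadic blocks) turns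
X into θ(p_c) = 0; the deciding theorem `closes` is proved in glue.lean from the four items — the
fourth, the support item TauLowerThetaSq (τ_p(0,x) ≥ θ(p)² on ℤ³, PROVED in tree, shared with route
PercTwoPointDecay as stmt-CriticalPhenomena-0837), is filed as an item precisely so that the route
file imports only `Literature.Probability.Percolation.TwoPointFunction` (cone repair 2026-08-15: no
unproved named fact beyond the sub-problem Statement's own import closure).
Lean: `(∀ p : unitInterval, p ≤ Literature.Probability.Percolation.criticalProbI 3 → ∀ n : ℕ,
Literature.Probability.Percolation.tau 3 p 0 (Pi.single 0 ((n + 1 : ℕ) : ℤ)) ^ 2 ≤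
Literature.Probability.Percolation.tau 3 p 0 (Pi.single 0 (n : ℤ)) *
Literature.Probability.Percolation.tau 3 p 0 (Pi.single 0 ((n + 2 : ℕ) : ℤ))) ∧ (∃ c c' : ℝ, c' < c
∧ ∃ (p : ℕ → unitInterval) (N : ℕ → ℕ) (C : ℕ → ℝ), (∀ k, 0 < (p k : ℝ) ∧ p k ≤
Literature.Probability.Percolation.criticalProbI 3) ∧ (∀ M : ℕ, ∃ k, M ≤ N k) ∧ (∀ k n : ℕ,
Literature.Probability.Percolation.tau 3 (p k) 0 (Pi.single 0 (n : ℤ)) ≤ C k * Real.exp (-(c / N k)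
* n)) ∧ (∀ k n : ℕ, (N k : ℝ) ≤ 2 * n → n ≤ N k → Real.exp (-(c' / N k)) *
(Literature.Probability.Percolation.tau 3 (p k) 0 (Pi.single 0 (n : ℤ)) *
Literature.Probability.Percolation.tau 3 (Literature.Probability.Percolation.criticalProbI 3) 0
(Pi.single 0 ((n + 1 : ℕ) : ℤ))) ≤ Literature.Probability.Percolation.tau 3 (p k) 0 (Pi.single 0 ((n
+ 1 : ℕ) : ℤ)) * Literature.Probability.Percolation.tau 3
(Literature.Probability.Percolation.criticalProbI 3) 0 (Pi.single 0 (n : ℤ))))`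

## Assembly
Plumbing only, PROVED in glue.lean (`closes (h1 : AxialLogConvex) (h2 : BlockCrossover) (h3 :
KinkCriterion) (h4 : TauLowerThetaSq) : _root_.PercolationContinuityZ3`, axioms
propext/Classical.choice/Quot.sound, planner Sketch.lean rc 0 with imports
Summits.CriticalPhenomena.Statement + Literature.Probability.Percolation.TwoPointFunction only):
unfold PercolationContinuityZ3 to θ := theta (zdGraph 3) 0 (criticalProbI 3) = 0; by contradiction θ
> 0 (measureReal_nonneg); apply KinkCriterion to a(n) := tau 3 p_c 0 (n e₁) with θ² ≤ a(n)
(hypothesis h4 = TauLowerThetaSq at p = p_c, x = n e₁; tau_def is rfl — in tree this is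
Literature.Probability.Percolation.Grimmett1999_theta_sq_le_openConn_holds 3,
ConnectivityThetaSqProofs.lean:157, deliberately NOT imported by the route file because its import
chain ConnectivityThetaSqProofs → UniquenessInfiniteCluster → BurtonKeaneCombinatorics →
ConstrainedClusters → HalfSpaceBGN → HalfSpace carries the unproved named facts
BarskyGrimmettNewman1991 and Grimmett1999_lemma_7_52, which nothing in this route uses), a(n) ≤ 1
(tau_le_one), log-convexity from AxialLogConvex at p = p_c (le_rfl); for each M take k with M ≤ N_k
from BlockCrossover and b(n) := tau 3 (p k) 0 (n e₁), positive by tau_pos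
(zdGraph_preconnected_holds, 0 < p_k), log-convex by AxialLogConvex at p_k ≤ p_c, with the
exponential bound and the block inequality read off BlockCrossover verbatim. The Assembly item below
is then `fun h1 h2 h3 h4 => closes h1 h2 h3 h4`.

Rationale: WHY THIS LINE. Mechanism (card axial-effective-mass-log-convexity; transplant from lattice-QFT
spectroscopy / the Stieltjes moment problem with an explicit dictionary: positive transfer matrix ↦
König–Richthammer layer chain on infection patterns of G×ℤ, KonigRichthammer2025 = arXiv:2207.13173
Prop. 3; Källén–Lehmann measure ↦ signed eigen-expansion a(n) = Σ w_i λ_iⁿ of the axial functional;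
mass gap ↦ 1/ξ(p); LRO atom ↦ θ(p)²): under reflection positivity (FrohlichIsraelLiebSimon1978,
FrohlichSimonSpencer1976; FK with integer q ≥ 2, Biskup1998) n ↦ ⟨O θⁿO⟩ is a Stieltjes moment
sequence, hence completely monotone, hence log-convex; at q = 1 RP of connectivity fails (card
no-os-positivity-connectivity) and complete monotonicity fails (the card's exact ladder theorem:
Hankel₃ determinant −225/481890304 at p = 1/2), yet in exact rational arithmetic LCX holds for all n
≤ 420 on every vertex-transitive tube cross-section tested (C₂…C₇, K₄, K₅, the 2×2, 2×3 and 3×3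
tubes of ℤ³ incl. p ≈ p_c(ℤ³)), with a visible cause: the second transfer mode is real, positive and
positively weighted. What LCX buys that the folklore ORDER-1 monotonicity (KonigRichthammer2025
Conj. 1; LimaProcacciSanchis2015 Thm 1 for small p via Ornstein–Zernike, CampaninoIoffeVelenik2008)
does not: a KINK LEMMA — a positive log-convex sequence with terminal rate 1/ξ has every ratio ≤
e^{−1/ξ}, so a subcritical a_p cannot plateau and then decay; in a jump world a_{p_c}(n) ↓ θ(p_c)² >
0 (τ ≥ θ², PROVED in tree: Grimmett1999_theta_sq_le_openConn_holds; carried here as the support item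
TauLowerThetaSq) has summable slopes, while BlockCrossover transfers the subcritical slope bound
−c/N_k, up to c'/N_k, onto disjoint dyadic blocks of critical slopes, whose sum diverges. Imported
areas: transfer-operator spectral positivity / moment problems (for the conjecture and its
evidence), elementary convex analysis (the glue), near-critical crossover scaling
(GrimmettPercolation1999 §9.1–9.2, BorgsChayesKestenSpencer1999) for K2. No prior route on this sub
uses convexity in the distance: PercLevyKhintchine is Schoenberg negative type over point sets,
PercTreeValue's log-convexity is in the number of points, PercLayerChain uses the layer chain for a
shadow density, PercTwoPointDecay wants an averaged power saving; the negatives index (5 statements;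
stmt-7073 on this sub) is untouched.

RANKED CRUXES. #2 AxialLogConvex (crux) — (card K1) for every p ∈ [0,1] with p ≤ p_c(ℤ³) and every n
∈ ℕ: τ_p(0,(n+1)e₁)² ≤ τ_p(0,n e₁)·τ_p(0,(n+2)e₁), i.e. n ↦ log τ_p(0, n e₁) is convex (the axial
effective mass is non-increasing in n). n = 0 is FKG; the content is n ≥ 1, uniformly up to p_c.
[difficulty: open-problem] (why it might fail: LCX is not universal: on star tubes S₃×ℤ, S₄×ℤ with
central base point at p=3/4 the 2nd transfer mode is a complex pair and LCX fails by 1e-16 at n≈16;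
transitive-tube evidence stops at width 7 (2D) / 3×3 (3D); at p_c on ℤ³ the transfer spectrum is
continuous and no q=1 positivity is known.) [KonigRichthammer2025, arXiv:2207.13173,
LimaProcacciSanchis2015, FrohlichIsraelLiebSimon1978, Biskup1998, GrimmettPercolation1999]
#3 BlockCrossover (crux) — (card K2, margin constant freed: any c' < c instead of c' = c/2, and 0 <
p_k made explicit) ∃ c' < c, p_k ∈ (0, p_c], N_k unbounded, C_k: τ_{p_k}(0,n e₁) ≤ C_k e^{−(c/N_k)n}
∀ n, and for N_k/2 ≤ n ≤ N_k: e^{−c'/N_k} τ_{p_k}(0,n e₁) τ_{p_c}(0,(n+1)e₁) ≤ τ_{p_k}(0,(n+1)e₁)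
τ_{p_c}(0,n e₁). The first clause holds with C_k = 1, c/N_k = 1/ξ(p_k) (GrimmettPercolation1999 Thm
(6.44), (6.46)) and ξ(p) → ∞ as p ↑ p_c (ibid. Thm (6.14)); the content is the ratio comparison at n
≍ ξ(p_k): in scaling form, the deficit D(t) = −log[τ_p/τ_{p_c}](tξ) has D′ ≤ c'/c < 1 on one dyadic
block [c/2, c]. [difficulty: open-problem] (why it might fail: crossover regularity with a margin at
n≍ξ(p): scaling gives D(t)≈A·t^(1/ν) as t→0, so D′<1 on a small block needs ν<1 (d=3: 1/ν=1.141,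
arXiv:1302.0421; in d=2 ν=4/3 and the clause should FAIL); no rigorous control of τ_p at scale ξ(p)
exists on ℤ³, and with LCX it is conjunct-strength.) [GrimmettPercolation1999,
CampaninoIoffeVelenik2008, BorgsChayesKestenSpencer1999, arXiv:1302.0421, doi:10.1007/BF01418864]
#9 KinkCriterion (support) — (card P1 + the analytic half of P2, percolation-free) Let a : ℕ → ℝ
with θ ≤ a(n) ≤ 1 (θ > 0) be log-convex, and let c' < c. Suppose that for every M there are N ≥ M, C
and a positive log-convex b : ℕ → ℝ with b(n) ≤ C e^{−(c/N)n} for all n and e^{−c'/N} b(n) a(n+1) ≤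
b(n+1) a(n) for N/2 ≤ n ≤ N. Then False. Proof (1 page): kink lemma — slopes of log b increase to
their limit ≤ −c/N, so log b(n+1) − log b(n) ≤ −c/N ∀ n; hence s_n := log a(n+1) − log a(n) ≤
(c'−c)/N on the block (⌊N/2⌋+1 ≥ N/2 terms, sum ≤ −(c−c')/2); log a convex and bounded ⇒ s_n ≤ 0 ∀
n; choosing blocks with N_{j+1} ≥ 2N_j + 1 (disjoint), log a(N_J+1) − log a(0) ≤ −J(c−c')/2,
contradicting log a ≥ log θ for J large. [difficulty: provable-now] [GrimmettPercolation1999 (App.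
II Thm (11.2) subadditivity, shape of the kink lemma), card:axial-effective-mass-log-convexity]
#9 TauLowerThetaSq (support, added by the cone repair 2026-08-15) — for every p ∈ [0,1] and every x
∈ ℤ³: θ(p)² ≤ τ_p(0,x) = P_p(0 ↔ x) (Harris–FKG on {|C(0)|=∞}, {|C(x)|=∞} plus a.s. uniqueness of
the infinite cluster; GrimmettPercolation1999 §8.5 p. 213 with Thm (8.1)). KNOWN and PROVED in tree:
`Literature.Probability.Percolation.Grimmett1999_theta_sq_le_openConn_holds`
(ConnectivityThetaSqProofs.lean:157, via the proved ℤ^d uniqueness UniquenessInfiniteCluster.lean);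
the item is the SAME ledger statement as PercTwoPointDecay.TauLowerThetaSq
(stmt-CriticalPhenomena-0837: grounded, refuter-checked, rc-0 one-line candidate `fun p x =>
Grimmett1999_theta_sq_le_openConn_holds 3 p 0 x` attached) and one Theorems file discharges it for
both routes. It is an item, not an import, so that this route file's import closure stays that of
the Statement + TwoPointFunction. [difficulty: provable-now] [GrimmettPercolation1999 §8.5 p. 213,
Thm (8.1); Literature.Probability.Percolation.Grimmett1999_theta_sq_le_openConn]

TWO-LAYER PLAN. Foreseen glued splits (k ≤ 3, depth 1), filed only after a crux moves:
AxialLogConvex ⇐ TubeAxialLogConvex (LCX with base point on the axis of every transitive tube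
C_k²×ℤ, all k, p, n — the transfer-spectral statement: second mode of the König–Richthammer pattern
chain real, positive, positively weighted in the axial functional) → TubeToZ3 (τ on C_k²×ℤ → τ on ℤ³
as k → ∞, KonigRichthammer2025 Prop. 1(b) pattern; LCX is closed under pointwise limits) →
AxialLogConvex; alternatively by regime: SubcritAxialLogConvex (p < p_c) → LCXClosedInP (continuity
of p ↦ τ_p(0,x), GrimmettPercolation1999 §8.3, tree fact Grimmett1999_continuous_openConn) →
AxialLogConvex. BlockCrossover ⇐ CorrelationLengthDiverges (ξ(p) → ∞ as p ↑ p_c with τ_p(0,ne₁) ≤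
e^{−n/ξ(p)}, GrimmettPercolation1999 Thms (6.14), (6.44)) → RatioCrossover (the block inequality
with N = ⌈c ξ(p)⌉ for all p in a left neighbourhood of p_c) → BlockCrossover.

KILL CRITERIA. AxialLogConvex: a proof of ¬AxialLogConvex (any p ≤ p_c, any n) closes the route
`refuted:AxialLogConvex` — there is no weaker positivity to retreat to (order-1 monotonicity does
not feed the kink lemma). Evidence-level kills that force the same close: an exact LCX violation
with on-axis base point on a vertex-transitive tube C_k²×ℤ or C_k×ℤ at some p ≤ p_c(ℤ³)+0.05, or an
axial eigen-expansion on such a tube whose second mode has negative/complex weight (LCX then fails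
at large n), or Monte Carlo on ℤ³ at p_c showing r_n = τ(n+1)/τ(n) decreasing in n beyond 3σ for
some n ≤ 10. BlockCrossover: ¬BlockCrossover proved (e.g. critical ratios provably steeper than
subcritical ones at scale ξ) ⇒ pivot to the card's weaker pairing (LCX + hyperscaling-type gluing of
card box-hyperscaling-gluing) as a NEW route, close this one `refuted:BlockCrossover`. Mooted if
PercTwoPointDecay.SubcritBallAverageDecay or any route proving τ_{p_c}(0,x) → 0 lands (then θ(p_c)=0
directly).

NOT DECOMPOSED YET. The tube-level LCX theorem and the tube → ℤ³ limit (layer-2 children of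
AxialLogConvex); the ladder theorem (exact order-3 recurrence on ℤ×{0,1}, LCX ∀ n, not completely
monotone) and the exact negative certificates (Hankel₃ < 0; point-to-plane and off-axis functions
not log-convex) — Literature-side delimiters a prover may attach with `--supports AxialLogConvex`,
not items; the leading-order lemma r_n = p(1 + 2(d−1)(n+1)p² + O(p³)); the identification N_k = ⌈c
ξ(p_k)⌉ and ξ(p) → ∞ inside BlockCrossover (known, GrimmettPercolation1999 Thms (6.14), (6.44)); any
all-p (supercritical) or all-d version of LCX; the constant bookkeeping c' < c (freed from the
card's c/2 already).

CHEAPEST FALSIFIER. Exact transfer-matrix arithmetic (card folder cm/, run by the card's author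
2026-08-15): LCX checked with NO violation for n ≤ 420 on C₂, C₃, L₃, C₄ (= 2×2 tube of ℤ³), K₄ × 9
rational p, in floats (n ≤ 40–60) on C₅, C₆, C₇, L₄, L₂×L₃, K₅ and on the 3×3 torus tube C₃×C₃×ℤ at
p ∈ {0.2488, 0.5}; complete monotonicity and off-axis/point-to-plane log-convexity FALSIFIED there
(delimiters). Next cheapest, not yet run: (a) the 4×4 torus tube C₄×C₄×ℤ at p = 0.2488 (second-mode
sign in the axial eigen-expansion); (b) Monte Carlo on ℤ³ at p = 0.2488 of r_n =
τ(0,(n+1)e₁)/τ(0,ne₁), n ≤ 8, to 10⁻³ (LCX ⟺ r_n non-decreasing); (c) for BlockCrossover: MC at p =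
0.23, 0.24 (ξ ≈ 5–15) of s_n(p_c) − s_n(p) for n ∈ [ξ/2, ξ] against the budget (c − c')/N with N =
⌈cξ⌉ — a measured deficit slope D′(t) ≥ 1 on every block t ≤ 2 kills K2.

NUMBERS. p_c(ℤ³, bond) = 0.2488126(5), 1/ν = y_t = 1.1410(15) (ν = 0.8764), d_f = 2.52295(15) so η =
5 − 2d_f = −0.0459 (arXiv:1302.0421; doi:10.1007/s11467-013-0403-z); hence at p_c a_{p_c}(n) ≈
n^{−(1+η)} = n^{−0.954} (log-convex with margin (1+η)/n²) and the crossover deficit D(t) ≍ t^{1.141}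
as t → 0 (D′ → 0: the BlockCrossover window exists in scaling theory; in d = 2, 1/ν = 3/4 and D′ →
∞). Subcritical: τ_p(0,ne₁) ≤ e^{−n/ξ(p)} ∀ n and −(1/n) log τ_p(0,ne₁) → 1/ξ(p)
(GrimmettPercolation1999 Thm (6.44), (6.45)–(6.46)); Ornstein–Zernike τ_p(0,ne₁) ~ Ψ_p n^{−(d−1)/2}
e^{−n/ξ(p)} = Ψ_p n^{−1} e^{−n/ξ} in d = 3 (doi:10.1007/BF01418864; CampaninoIoffeVelenik2008),
log-convex for n ≫ ξ with margin 1/n². Card evidence: LCX exact for n ≤ 420 on 5 graphs × 9 rational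
p; ladder theorem at p = 1/2: a_{n+3} = a_{n+2} − a_{n+1}/4 + a_n/64, Hankel₃ det = −225/481890304.
Items at open: 4 (2 cruxes, 1 support, 1 assembly); after the cone repair of 2026-08-15: 5 (2
cruxes, 2 support, 1 assembly; no separate target: X is the conjunction of the two cruxes and
`closes` takes them plus the two provable-now support items directly).

DEFINITION REQUESTS. None: `Literature.Probability.Percolation.tau`, `criticalProbI`, `theta`,
`zdGraph` exist; the correlation length ξ(p) is not needed as a declaration (BlockCrossover
quantifies the scales N_k directly). CONE (route-repair 2026-08-15): route imports =
[Literature.Probability.Percolation.TwoPointFunction] (adds TwoPointFunction,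
BondPercolationSymmetry, SitePercolationMeasure to the Statement's closure and NO named fact);
`Literature.Probability.Percolation.ConnectivityThetaSqProofs` was DROPPED: the route used it only
for the proved τ ≥ θ² inside `closes`, while its import chain ConnectivityThetaSqProofs →
UniquenessInfiniteCluster → BurtonKeaneCombinatorics → ConstrainedClusters → HalfSpaceBGN →
HalfSpace carries the UNPROVED named facts
`Literature.Probability.Percolation.BarskyGrimmettNewman1991` (general-d half-space continuity) and
`Literature.Probability.Percolation.Grimmett1999_lemma_7_52`, neither of which any item here uses
(needs-fact: none). Library-hygiene request filed alongside (definition work item, topic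
Literature/Probability/Percolation): move the two BGN bridge lemmas
`BGN.brickPathGraph_eq_inf_starGraph`, `BGN.brickPathGraph_reachable_iff` out of
ConstrainedClusters.lean into a module of their own and drop its HalfSpaceBGN import, so that the
Theorems file discharging TauLowerThetaSq (which must import ConnectivityThetaSqProofs) does not
re-import the two facts when the gate links `TauLowerThetaSq_holds` here.

SUPPORT. KinkCriterion (stmt-CriticalPhenomena-11551), TauLowerThetaSq (stmt-CriticalPhenomena-0837,
one line, see #9) and the Assembly (restated 2026-08-15 with TauLowerThetaSq as 4th hypothesis: `fun
h1 h2 h3 h4 => closes h1 h2 h3 h4`) are provable NOW; the planner machine-checked both privately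
against the landed route file (2026-08-15, folder KinkMatch.lean, ≈170 lines, `lean check` rc 0,
axioms propext/Classical.choice/Quot.sound; provers re-prove in Theorems). Skeleton for the prover:
(i) kink lemma `slope_le_of_linear_bound (g : ℕ → ℝ) (A r : ℝ) (hmono : ∀ n, g (n+1) - g n ≤ g (n+2)
- g (n+1)) (hbd : ∀ n, g n ≤ A - r * n) : ∀ n, g (n+1) - g n ≤ -r` — by contradiction from a slope d
> -r at m: induction gives d ≤ g(m+j+1) - g(m+j) and g m + j*d ≤ g(m+j), then `exists_nat_gt ((A -
r*m - g m)/(d+r))`, `div_lt_iff₀`, linarith; (ii) with f := Real.log ∘ a (log-convexity ⇒ monotone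
slopes via Real.log_le_log, Real.log_pow, Real.log_mul) apply (i) with A = r = 0 to get f antitone
(`antitone_nat_of_succ_le`); (iii) STEP: for any n take the hypothesis at M := 2n+1, g := Real.log ∘
b, C > 0 from n = 0, g k ≤ log C - (c/N) k (Real.log_mul, Real.log_exp), (i) gives g(k+1) - g k ≤
-(c/N); logs of the block inequality give f(k+1) - f k ≤ -((c-c')/N) for N ≤ 2k, k ≤ N; with m₀ := N
- N/2 (omega: n ≤ m₀, N ≤ 2m₀, m₀ + (N/2+1) = N+1) induct j ↦ f(m₀+j) ≤ f m₀ - j(c-c')/N up to j =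
N/2+1, and (N/2+1)(c-c')/N ≥ (c-c')/2 =: δ (nlinarith with N·((c-c')/N) = c-c' by field_simp and N ≤
2(N/2)+1), so f(N+1) ≤ f n - δ using antitone f; (iv) iterate: ∀ J, ∃ n, f n ≤ -J δ; `exists_nat_gt
(-Real.log θ / δ)` contradicts Real.log θ ≤ f n. Assembly is `fun h1 h2 h3 h4 => closes h1 h2 h3 h4`
(closes is in the route file). Consequence (the 2026-08-15 sketch had the 3-hypothesis form; with
the repaired glue it reads): `theorem statement_of_cruxes (h1 : AxialLogConvex) (h2 :
BlockCrossover) : PercolationContinuityZ3 := closes h1 h2 kinkCriterion_holds tauLowerThetaSq_holds`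
with `tauLowerThetaSq_holds := fun p x => Grimmett1999_theta_sq_le_openConn_holds 3 p 0 x` in a
Theorems file — the route decides the conjunct modulo its two cruxes only.

Novelty: Searches (2026-08-15, this planner; searchd FTS leg and OpenAlex/S2 rate-limited part of the
session): `lit search --hybrid "log-convexity connectivity function percolation distance effective
mass"` (10 book hits, vector only, none on-topic: Grimmett1999, HeydenreichVanDerHofstad2017,
Slade2006 …); `lit search --source arxiv "monotonicity two-point function percolation"` (7; 1
relevant: arXiv:1504.06549); `lit search --source arxiv "log-convexity two-point correlation
function lattice distance reflection positivity effective mass"` (0); `lit search --source crossref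
"monotonicity Bernoulli percolation layered graphs Markov chain"` (10; 1 relevant:
doi:10.1016/j.spa.2024.104549 = KonigRichthammer2025, READ pp. 3–6: Conj. 1–3, Prop. 1, Prop. 3, Thm
1); `lit galaxy search "log-convexity of the two-point function" | "connectivity function is
log-convex" | "monotonicity of the connectivity function percolation" | "monotonicity of the
two-point function" --star all` (0, 0, 0, 2 irrelevant); `lit frontier CriticalPhenomena --since
2023` (30 rows; none on distance-monotonicity/convexity of τ; nearest arXiv:2605.30299 reversed
Simon–Lieb, high d); GrimmettPercolation1999 read pp. 126–128 (Thm (6.44), subadditivity — order-0/1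
information only). Plus the card author's logged searches (zbMATH "bunkbed conjecture" 16 rows incl.
arXiv:2410.02545; "log-convex connectivity percolation" 0).
Nearest prior art found: KonigRichthammer2025 / arXiv:2207.13173 (ORDER-1 monotonicity: folklore
Conj.  [refs: 10.1016/j.spa.2024.104549, 1504.06549, 2605.30299, 2410.02545, 2207.13173, doi:10.1016/j.spa.2024.104549, Grimmett1999, HeydenreichVanDerHofstad2017, KonigRichthammer2025, GrimmettPercolation1999, LimaProcacciSanchis2015, FrohlichIsraelLiebSimon1978, Biskup1998]

Barriers (technique_class: transfer-spectral positivity, log-convexity, kink-lemma): - technique_class: transfer-spectral positivity, log-convexity, kink-lemma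
- Literature.Barriers.CriticalPhenomena.GaussianDominationRoute: not in class — no reflection
positivity, Gaussian domination or infrared bound is used or claimed (RP of connectivity provably
fails on the graphs where LCX holds); η < 0 on ℤ³ is accommodated, not fought: every power law
n^(−(1+η)), η > −1, is log-convex; the closing is kink lemma + crossover, not τ_(p_c) ≤ C|x|^(2−d).
Conceded: BlockCrossover is where conjunct-strength, near-critical content sits.
- Literature.Barriers.CriticalPhenomena.GaussianDominationRouteNarrow: its blocked half — SUPPLY of
a uniform subcritical two-point bound by Gaussian domination of a quadratic spin Hamiltonian /
continuation in q — is not used: no spin representation, no q ≠ 1, no infrared bound; its proved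
closing half (τ_{p_c} → 0 ⇒ θ = 0) is the kind of x-space closing the kink lemma reaches by summing
slope deficits.
- Literature.Barriers.CriticalPhenomena.IsingTrivialityFromDimensionFour: n/a (Ising non-triviality,
other conjunct); note θ(p_c) = 0 is expected in every d ≥ 2, so dimension-uniformity of LCX would be
no defect — and BlockCrossover is NOT dimension-uniform (its window needs ν < 1, false in d = 2).
- Literature.Barriers.CriticalPhenomena.LongRangeTrivialityOnZ3: n/a (Ising triviality methods);
shared vocabulary only (spectral representation) — and the card's ladder theorem shows percolation
has NO positive spectral representation, so nothing i

History (route lifecycle, newest last):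
- 2026-08-15T18:41:06Z · rev 2: restated Assembly (stmt-CriticalPhenomena-11552) — route-repair (cone guardrail 2026-08-15): RE-ROUTED AROUND the 2 extra unproved cone facts BarskyGrimmettNewman1991 + Grimmett1999_lemma_7_52 (needs-fact: none) (planner-rrepair-CriticalPhenomena-PercAxialLog-9d204770-0)
- 2026-08-26T07:51:00Z · DORMANT — reconciler: no traction for 8.4 d (last activity item-evidence-added at 2026-08-17T21:52:39Z); parked, not closed — `ledger route dormant route-CriticalPhenomen (operator:999:2223070)

sub-problem: PercolationContinuityZ3 · status: dormant · opened planner-plancard-CriticalPhenomena-Percolatio-f3ee8be6-0 2026-08-15T18:23:23Z · rev 3 · ledger route-CriticalPhenomena-PercAxialLogConvexity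
GENERATED by the gate from the ledger (D-0016/17). Provers cite these decls: `theorem foo : Summit.CriticalPhenomena.PercolationContinuityZ3.Theses.PercAxialLogConvexity.<Decl> := …` in Summits/CriticalPhenomena/PercolationContinuityZ3/Theorems/<Name>.lean.
-/

namespace Summit.CriticalPhenomena.PercolationContinuityZ3.Theses.PercAxialLogConvexity

open scoped BigOperators Topology Manifold Classical MeasureTheory ProbabilityTheory Matrix InnerProductSpace ComplexConjugate ContinuousMap
open Filter Set Function TopologicalSpace MeasureTheory

attribute [summit_statement] _root_.PercolationContinuityZ3

/-- item stmt-CriticalPhenomena-11549 · crux · rank 2 · open · by planner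
why it might fail: ORDER-1 monotonicity of τ_p(0,ne₁) in n is open beyond small p (arXiv:1504.06549 Thm 1; KonigRichthammer2025 Conj. 1); no q=1 spectral positivity exists; LCX provably FAILS off transitivity (star tube S₃×ℤ, central base point, p=3/4: complex 2nd mode, n≈16); at p_c on ℤ³ the spectrum is continuous.
sources: KonigRichthammer2025, arXiv:2207.13173, LimaProcacciSanchis2015, arXiv:1504.06549, FrohlichIsraelLiebSimon1978, Biskup1998
[crux] (card K1) for every p ∈ [0,1] with p ≤ p_c(ℤ³) and every n ∈ ℕ: τ_p(0,(n+1)e₁)² ≤ τ_p(0,n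
e₁)·τ_p(0,(n+2)e₁), i.e. n ↦ log τ_p(0, n e₁) is convex (the axial effective mass is non-increasing
in n). n = 0 is FKG; the content is n ≥ 1, uniformly up to p_c. [difficulty: open-problem] -/
@[route_item "route-CriticalPhenomena-PercAxialLogConvexity"]
def AxialLogConvex : Prop :=
  ∀ p : unitInterval, p ≤ Literature.Probability.Percolation.criticalProbI 3 → ∀ n : ℕ, Literature.Probability.Percolation.tau 3 p 0 (Pi.single 0 ((n + 1 : ℕ) : ℤ)) ^ 2 ≤ Literature.Probability.Percolation.tau 3 p 0 (Pi.single 0 (n : ℤ)) * Literature.Probability.Percolation.tau 3 p 0 (Pi.single 0 ((n + 2 : ℕ) : ℤ))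

/-- item stmt-CriticalPhenomena-11550 · crux · rank 3 · open · by planner
why it might fail: Needs RATIO-level crossover control at n≍ξ(p_k)→∞ with margin: scaling form D(t)=−log(τ_p/τ_{p_c})(tξ)≈A·t^{1/ν} opens a small-t block with D′<c′/c<1 only because 1/ν=1.141>1 in d=3 (arXiv:1302.0421; for ν=4/3 as in d=2 it closes); scaling corrections uncontrolled; nothing rigorous at scale ξ on ℤ³.
sources: GrimmettPercolation1999, CampaninoIoffeVelenik2008, BorgsChayesKestenSpencer1999, Kesten1987Scaling, SmirnovWernerMRL2001, arXiv:1302.0421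
[crux] (card K2, margin constant freed: any c' < c instead of c' = c/2, and 0 < p_k made explicit) ∃
c' < c, p_k ∈ (0, p_c], N_k unbounded, C_k: τ_{p_k}(0,n e₁) ≤ C_k e^{−(c/N_k)n} ∀ n, and for N_k/2 ≤
n ≤ N_k: e^{−c'/N_k} τ_{p_k}(0,n e₁) τ_{p_c}(0,(n+1)e₁) ≤ τ_{p_k}(0,(n+1)e₁) τ_{p_c}(0,n e₁). The
first clause holds with C_k = 1, c/N_k = 1/ξ(p_k) (GrimmettPercolation1999 Thm (6.44), (6.46)) and
ξ(p) → ∞ as p ↑ p_c (ibid. Thm (6.14)); the content is the ratio comparison at n ≍ ξ(p_k): in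
scaling form, the deficit D(t) = −log[τ_p/τ_{p_c}](tξ) has D′ ≤ c'/c < 1 on one dyadic block [c/2,
c]. [difficulty: open-problem] -/
@[route_item "route-CriticalPhenomena-PercAxialLogConvexity"]
def BlockCrossover : Prop :=
  ∃ c c' : ℝ, c' < c ∧ ∃ (p : ℕ → unitInterval) (N : ℕ → ℕ) (C : ℕ → ℝ), (∀ k, 0 < (p k : ℝ) ∧ p k ≤ Literature.Probability.Percolation.criticalProbI 3) ∧ (∀ M : ℕ, ∃ k, M ≤ N k) ∧ (∀ k n : ℕ, Literature.Probability.Percolation.tau 3 (p k) 0 (Pi.single 0 (n : ℤ)) ≤ C k * Real.exp (-(c / N k) * n)) ∧ (∀ k n : ℕ, (N k : ℝ) ≤ 2 * n → n ≤ N k → Real.exp (-(c' / N k)) * (Literature.Probability.Percolation.tau 3 (p k) 0 (Pi.single 0 (n : ℤ)) * Literature.Probability.Percolation.tau 3 (Literature.Probability.Percolation.criticalProbI 3) 0 (Pi.single 0 ((n + 1 : ℕ) : ℤ))) ≤ Literature.Probability.Percolation.tau 3 (p k) 0 (Pi.single 0 ((n + 1 : ℕ) : ℤ)) * Literature.Probability.Percolation.tau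 3 (Literature.Probability.Percolation.criticalProbI 3) 0 (Pi.single 0 (n : ℤ)))

/-- item stmt-CriticalPhenomena-0837 · support · rank 9 · closed · proved by Summit.CriticalPhenomena.PercolationContinuityZ3.Theorems.tauLowerThetaSq_proof @ f648441f8c8f (prover) · by planner
sources: GrimmettPercolation1999 §8.5 p. 213, Thm (8.1), Literature.Probability.Percolation.Grimmett1999_theta_sq_le_openConn
[support] τ_p(0,x) ≥ θ(p)² for every p ∈ [0,1] and x ∈ Z^3: P_p(0↔x) ≥ P_p(|C(0)|=∞, |C(x)|=∞) ≥
θ(p)² by a.s. uniqueness of the infinite cluster (AizenmanKestenNewmanCMP1987 / Burton–Keane,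
Grimmett1999 Thm (8.1)) and Harris–FKG (Literature.Probability.Percolation.harris_fkg, Grimmett1999
Thm (2.4)); Grimmett1999 §8.5, display on p.213. Expected to close by citation + two lines; a Z^d
uniqueness fact is wanted in Literature (only the Z^2 form unique_infinite_cluster exists). -/
@[route_item "route-CriticalPhenomena-PercAxialLogConvexity"]
def TauLowerThetaSq : Prop :=
  ∀ (p : unitInterval) (x : Literature.Probability.LatticeModels.Site 3), Literature.Probability.Percolation.theta (Literature.Probability.LatticeModels.zdGraph 3) 0 p ^ 2 ≤ (Literature.Probability.Percolation.bondPercolation (Literature.Probability.LatticeModels.zdGraph 3) p).real (Literature.Probability.Percolation.openConn 0 x)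

-- `TauLowerThetaSq` holds: proved by `Summit.CriticalPhenomena.PercolationContinuityZ3.Theorems.tauLowerThetaSq_proof` @ f648441f8c8f (its module imports this route file, so no `_holds` link can be stated here).

/-- item stmt-CriticalPhenomena-11551 · support · rank 9 · closed · proved by Summit.CriticalPhenomena.PercolationContinuityZ3.Theorems.kinkCriterion_proof (prover) · by planner
sources: GrimmettPercolation1999 (App. II Thm (11.2) subadditivity, shape of the kink lemma), card:axial-effective-mass-log-convexity
[support] (card P1 + the analytic half of P2, percolation-free) Let a : ℕ → ℝ with θ ≤ a(n) ≤ 1 (θ >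
0) be log-convex, and let c' < c. Suppose that for every M there are N ≥ M, C and a positive
log-convex b : ℕ → ℝ with b(n) ≤ C e^{−(c/N)n} for all n and e^{−c'/N} b(n) a(n+1) ≤ b(n+1) a(n) for
N/2 ≤ n ≤ N. Then False. Proof (1 page): kink lemma — slopes of log b increase to their limit ≤
−c/N, so log b(n+1) − log b(n) ≤ −c/N ∀ n; hence s_n := log a(n+1) − log a(n) ≤ (c'−c)/N on the
block (⌊N/2⌋+1 ≥ N/2 terms, sum ≤ −(c−c')/2); log a convex and bounded ⇒ s_n ≤ 0 ∀ n; choosing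
blocks with N_{j+1} ≥ 2N_j + 1 (disjoint), log a(N_J+1) − log a(0) ≤ −J(c−c')/2, contradicting log a
≥ log θ for J large. [difficulty: provable-now] -/
@[route_item "route-CriticalPhenomena-PercAxialLogConvexity"]
def KinkCriterion : Prop :=
  ∀ (a : ℕ → ℝ) (θ c c' : ℝ), 0 < θ → c' < c → (∀ n, θ ≤ a n) → (∀ n, a n ≤ 1) → (∀ n, a (n + 1) ^ 2 ≤ a n * a (n + 2)) → (∀ M : ℕ, ∃ (b : ℕ → ℝ) (N : ℕ) (C : ℝ), M ≤ N ∧ (∀ n, 0 < b n) ∧ (∀ n, b (n + 1) ^ 2 ≤ b n * b (n + 2)) ∧ (∀ n : ℕ, b n ≤ C * Real.exp (-(c / N) * n)) ∧ (∀ n : ℕ, (N : ℝ) ≤ 2 * n → n ≤ N → Real.exp (-(c' / N)) * (b n * a (n + 1)) ≤ b (n + 1) * a n)) → False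

-- `KinkCriterion` holds: proved by `Summit.CriticalPhenomena.PercolationContinuityZ3.Theorems.kinkCriterion_proof` (its module imports this route file, so no `_holds` link can be stated here).

-- earlier Assembly (stmt-CriticalPhenomena-11552, replaced 2026-08-15T18:41:06Z -> stmt-CriticalPhenomena-11735): retired by None — AxialLogConvex → BlockCrossover → KinkCriterion → _root_.PercolationContinuityZ3
/-- item stmt-CriticalPhenomena-11735 · assembly · rank 1 · closed · proved by Summit.CriticalPhenomena.PercolationContinuityZ3.Theorems.percAxialLogConvexityAssembly_proof @ 2b7c8b0311b0 (prover) · by planner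
sources: GrimmettPercolation1999 (§8.5 p. 213: τ ≥ θ², tree: Grimmett1999_theta_sq_le_openConn_holds PROVED), card:axial-effective-mass-log-convexity
[assembly] AxialLogConvex → BlockCrossover → KinkCriterion → TauLowerThetaSq →
PercolationContinuityZ3; it is `fun h1 h2 h3 h4 => closes h1 h2 h3 h4` with the deciding theorem
`closes` of this file (cone repair 2026-08-15: τ ≥ θ² enters as the support item TauLowerThetaSq
instead of the import ConnectivityThetaSqProofs). [sources: GrimmettPercolation1999 §8.5 p. 213 (τ ≥
θ²); card:axial-effective-mass-log-convexity] -/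
@[route_item "route-CriticalPhenomena-PercAxialLogConvexity"]
def Assembly : Prop :=
  AxialLogConvex → BlockCrossover → KinkCriterion → TauLowerThetaSq → _root_.PercolationContinuityZ3

-- `Assembly` holds: proved by `Summit.CriticalPhenomena.PercolationContinuityZ3.Theorems.percAxialLogConvexityAssembly_proof` @ 2b7c8b0311b0 (its module imports this route file, so no `_holds` link can be stated here).

/-! D-0027 §2.1 — DECIDING THEOREM (planner-authored via `route open/edit --closes-file`; by planner-rrepair-CriticalPhenomena-PercAxialLog-9d204770-0 2026-08-15T18:41:06Z):
its hypotheses are this route's items and its conclusion the sub-problem Statement (glue_lint), and it elaborates with this file. -/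

@[closes "route-CriticalPhenomena-PercAxialLogConvexity"] theorem closes (h1 : AxialLogConvex) (h2 : BlockCrossover) (h3 : KinkCriterion) (h4 : TauLowerThetaSq) :
    _root_.PercolationContinuityZ3 := by
  show Literature.Probability.Percolation.theta (Literature.Probability.LatticeModels.zdGraph 3)
      (0 : Literature.Probability.LatticeModels.Site 3)
      (Literature.Probability.Percolation.criticalProbI 3) = 0
  by_contra hne
  have hθnn : 0 ≤ Literature.Probability.Percolation.theta (Literature.Probability.LatticeModels.zdGraph 3)
      (0 : Literature.Probability.LatticeModels.Site 3)
      (Literature.Probability.Percolation.criticalProbI 3) := MeasureTheory.measureReal_nonneg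
  have hθpos : 0 < Literature.Probability.Percolation.theta (Literature.Probability.LatticeModels.zdGraph 3)
      (0 : Literature.Probability.LatticeModels.Site 3)
      (Literature.Probability.Percolation.criticalProbI 3) := lt_of_le_of_ne hθnn (Ne.symm hne)
  obtain ⟨c, c', hc, p, N, C, hp, hN, hexp, hblock⟩ := h2
  refine h3 (fun n => Literature.Probability.Percolation.tau 3
      (Literature.Probability.Percolation.criticalProbI 3) 0 (Pi.single 0 (n : ℤ))) _ c c'
    (pow_pos hθpos 2) hc ?_ ?_ ?_ ?_
  · intro n
    exact h4 _ _
  · intro n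
    exact Literature.Probability.Percolation.tau_le_one _ _ _
  · intro n
    exact h1 _ le_rfl n
  · intro M
    obtain ⟨k, hk⟩ := hN M
    refine ⟨fun n => Literature.Probability.Percolation.tau 3 (p k) 0 (Pi.single 0 (n : ℤ)), N k, C k, hk,
      ?_, ?_, ?_, ?_⟩
    · intro n
      exact Literature.Probability.Percolation.tau_pos
        Literature.Probability.LatticeModels.zdGraph_preconnected_holds (p k) (hp k).1 _ _
    · intro n
      exact h1 (p k) (hp k).2 n
    · intro n
      exact hexp k n
    · intro n hNn hnN
      exact hblock k n hNn hnN

end Summit.CriticalPhenomena.PercolationContinuityZ3.Theses.PercAxialLogConvexity
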